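/-
Copyright: the b2b-balaban T⁴-continuum CRUX team, row NE7b OWNER lineage `t4-ne7b-p1` (gen 124). Project licence.
-/
import Summits.QuantumFields.BalabanUV.T4Continuum.Spine.NE7b.SupZdCoarseInverseTorusLimit
import Mathlib.Analysis.Normed.Group.Tannery

/-!
# THE THERMODYNAMIC LIMIT OF THE RESPONSE: along the tower `3^k`, the torus road's response to a unit coarse source,
# `(D_k e_{σ_k b₀})(σ_k p) = Σ_{y′}T_k⁻¹(y′, σ_k b₀)ψ^k_{y′}(σ_k p)` ((100)∕(137): `T_k⁻¹` the inverse Schur complement, `ψ^k` the torus block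
# columns of `H[V∘wm_k]`), CONVERGES for every `b₀, p ∈ ℤ^d` to the infinite-volume response `h_{b₀}(p) = Σ′_{b′}M(b′,b₀)Ψ_{b′}(p)` of (200)
# — every `V : ℤ^d → [−λ, Λ]`, `d ≥ 3`, every mesh; Tannery's theorem over `b′ ∈ ℤ^d` with (199)'s convergence of `T_k⁻¹`, (184)'s of the block
# columns, and the uniform domination `c₁C₀e^{δ₁|b₀|₁}e^{−δ₁|b′|₁}` from (135)'s mesh- and volume-free decay of `T_k⁻¹` (row NE7b, node U5c;
# (135)∕(152)∕(184)∕(186)∕(199) BY NAME; [folklore])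

Cell `pub-balaban`, sub-cell `t4`, spine estimate NE7b (`T4WeightBudget.RelWeightBound`; the cell's OWN estimate — NOT PRINTED in
[Bałaban 1983–89], NOT PROVED).  Crux-route work under `Spine/NE7b/` by the row OWNER (`t4-ne7b-p1` gen 124, file (204)) under FREEZE
(0)'s crux-prover clause; NOTHING of Bałaban's is named as a Lean object, valued or asserted; no `T4Continuum/Support` leaf typed; no `def`,
no notation (both responses WRITTEN OUT; `ψ^k`, `Ψ`, `M` ANY data with their displayed properties); zero `sorry`.  Imports (BY NAME): the
OWNER's (199) `…SupZdCoarseInverseTorusLimit` (`torus_nextScale_inverse_tendsto`; through it (197) `torusNorm_eq_l1`, (186)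
`sum_window_reading`, `blockSource_window_reading`, (184) `bounded_solution_is_tower_limit`, (180) `torusNorm_le_l1`, `inWindow_of_le`, (152)
`supNorm_bound_road`, (148) `action_surjective`, (135) `nextScale_hessian_local`, (133) `action_injective`, (132) `isPseudoDist_torus`, (189)
`summable_exp_l1`), Mathlib's `tendsto_tsum_of_dominated_convergence` (Tannery), `tsum_eq_sum`.

WHY (located).  (199) made `(n+1)^dM` the limit of the torus next-scale Hessians; the road's other next-scale object is the response
`D = H⁻¹Q′*(Q′H⁻¹Q′*)⁻¹`, on the torus the finite superposition `Σ_{y′}T_k⁻¹(y′,y₀)ψ^k_{y′}`, on `ℤ^d` the series of (200).  Reading the torus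
sum through the window (`y′ = σb′`, `b′ ∈ W_k`) makes it a `ℤ^d` series with window-supported terms; each term converges (`T_k⁻¹(σb′,σb₀) →
M(b′,b₀)` by (199); `ψ^k_{σb′}(σp) → Ψ_{b′}(p)` by (184), the torus block column being the torus solution of the window reading of
`𝟙_{B n b′}` beyond the window radius of `b′`, (186)); and the terms are dominated uniformly in `k`: `|T_k⁻¹(σb′,σb₀)| ≤ c₁e^{−δ₁ρ_k(σb′,σb₀)}`
((135)) with `ρ_k(σb′,σb₀) ≥ ρ_k(σb′,0) − ρ_k(σb₀,0) = |b′|₁ − ρ_k(σb₀,0) ≥ |b′|₁ − |b₀|₁` on the window ((197), (180)), and `|ψ^k| ≤ C₀` ((152)).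

WHAT IS PROVED ([folklore]): **`torus_response_tendsto`** (for ALL `n`, `V` of the class, `Ψ`, cube limit `M`, tower family `ψ^k`, `b₀, p`:
`Σ_{y′}T_k⁻¹(y′,σ_kb₀)ψ^k_{y′}(σ_kp) → Σ′_{b′}M(b′,b₀)Ψ_{b′}(p)`); §2 toy.

HONEST (what this is NOT).  Pointwise convergence of the response to unit coarse sources (no rate typed here, though (199)∕(179) carry one;
general coarse sources by linearity on finite supports only); the torus → `ℤ^d` limit of the fluctuation COVARIANCE ((201)) is the same
argument once more and is not typed here; the LINEAR column only; `d ≥ 3` only; scalar skeleton ((A3), NC-NE7b-α UNRULED); nothing of the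
covariant propagators of [B4]–[B6]; nothing of Bałaban's asserted.  BY-NAME EFFECT ON THE WALL: NONE.  NE7b NOT PRINTED ∕ NOT PROVED; spine
PROVED 0∕9; rung (B)+1 — the programme's measures remain FINITE-torus statements; NOT the mass gap, NOT Clay.  HONEST DEPENDENCY:
continuum YM on T⁴ ⇐ BetaPertH ∧ nine spine estimates (0∕9 proved); BetaPertH ⇐ (D1) ∧ (D4) ∧ CAP+tail; G-an2-4 gates asym, D1 and NE2∕3∕4.
-/

set_option autoImplicit false

noncomputable section

namespace Summit.QuantumFields.BalabanUV.T4Continuum.NE7b.SupZdResponseTorusLimit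

open Real Filter Topology
open Literature.MathematicalPhysics.QuantumFieldTheory.Balaban1983to89
open B6QGQLower276 (X e blk B side chart mem_B sum_B sum_B_const card_cube blk_chart)
open Beta (Site siteOf windowMap siteOf_windowMap windowMap_siteOf)
open SupTorusBlockDistance (isPseudoDist_torus)
open SupTorusActionForm (action_injective)
open SupTorusSupNormBound (action_surjective)
open SupTorusSupNormRoad (supNorm_bound_road)
open SupTorusCoarseFloor (nextScale_hessian_local)
open SupZdPropagatorLimit (torusNorm_le_l1 inWindow_of_le)
open SupZdPropagatorRegularity (bounded_solution_is_tower_limit)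
open SupZdCoarseOperator (sum_window_reading blockSource_window_reading)
open SupZdExponentialSums (summable_exp_l1)
open SupZdCoarseTorusSeam (torusNorm_eq_l1)
open SupZdCoarseInverseTorusLimit (torus_nextScale_inverse_tendsto)

variable {d : ℕ}

/-! ## §1. THE END: the torus responses converge to the infinite-volume response -/

/-- **HEADLINE — THE THERMODYNAMIC LIMIT OF THE RESPONSE**: for `V : ℤ^d → [−λ, Λ]` (`d ≥ 3`, every mesh), ANY bounded `ℤ^d` block columns
`Ψ`, ANY cube limit `M` (= `T_∞⁻¹`), ANY family `ψ^k` of torus block columns along the tower `3^k`, every coarse `b₀` and fine `p ∈ ℤ^d`: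
the torus response `(D_k e_{σ_k b₀})(σ_k p) = Σ_{y′}T_k⁻¹(y′, σ_k b₀)ψ^k_{y′}(σ_k p)` ((100)∕(137)) CONVERGES to the infinite-volume response
`h_{b₀}(p) = Σ′_{b′}M(b′,b₀)Ψ_{b′}(p)` ((200)) — the torus sum is the `ℤ^d` series of the window-supported terms
`𝟙_{W_k}(b′)T_k⁻¹(σb′,σb₀)ψ^k_{σb′}(σp)`, which converge termwise ((199) for `T_k⁻¹`, (184) for the block columns) under the summable
domination `c₁C₀e^{δ₁|b₀|₁}e^{−δ₁|b′|₁}` ((135)'s uniform decay of `T_k⁻¹`, the torus distance from `σb′` to `σb₀` being `≥ |b′|₁ − |b₀|₁` on the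
window; (152)'s sup bound): Tannery's theorem. [folklore] -/
theorem torus_response_tendsto (hd : 3 ≤ d) (a : ℝ) (ha : 0 < a) {lam Lam : ℝ} (hlam : lam < min 2 a) (hLam : 0 ≤ Lam)
    (n : ℕ) (V : X d → ℝ) (hV : ∀ p, -lam ≤ V p) (hV' : ∀ p, V p ≤ Lam)
    (Ψ : X d → X d → ℝ) (BΨ : X d → ℝ) (hΨB : ∀ b' p, |Ψ b' p| ≤ BΨ b')
    (hΨ : ∀ b' p, ((n : ℝ) + 1) ^ 2 * ∑ μ, (2 * Ψ b' p - Ψ b' (p + e μ) - Ψ b' (p - e μ))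
      + a / ((n : ℝ) + 1) ^ d * ∑ q ∈ B n (blk n p), Ψ b' q + V p * Ψ b' p = if blk n p = b' then 1 else 0)
    (M : X d → X d → ℝ) (hM : ∀ b b' : X d, Tendsto (fun R : ℕ =>
        if h : b ∈ (Fintype.piFinset fun _ : Fin d => Finset.Icc (-(R : ℤ)) R) ∧
            b' ∈ (Fintype.piFinset fun _ : Fin d => Finset.Icc (-(R : ℤ)) R)
          then (Matrix.of fun c c' : ↥(Fintype.piFinset fun _ : Fin d => Finset.Icc (-(R : ℤ)) R) =>
            (((n : ℝ) + 1) ^ d)⁻¹ * ∑ q ∈ B n (c : X d), Ψ (c' : X d) q)⁻¹ ⟨b, h.1⟩ ⟨b', h.2⟩ else 0)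
      atTop (𝓝 (M b b')))
    (ψ : (k : ℕ) → Site d (3 ^ k) → Site d ((n + 1) * 3 ^ k) → ℝ)
    (hψ : ∀ (k : ℕ) (y' : Site d (3 ^ k)) (x : Site d ((n + 1) * 3 ^ k)),
      ((n : ℝ) + 1) ^ 2 * ∑ μ, (2 * ψ k y' x - ψ k y' (x + siteOf d ((n + 1) * 3 ^ k) (e μ)) - ψ k y' (x - siteOf d ((n + 1) * 3 ^ k) (e μ)))
        + a / ((n : ℝ) + 1) ^ d * ∑ q ∈ B n (blk n (windowMap d ((n + 1) * 3 ^ k) x)), ψ k y' (siteOf d ((n + 1) * 3 ^ k) q)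
        + V (windowMap d ((n + 1) * 3 ^ k) x) * ψ k y' x
        = if siteOf d (3 ^ k) (blk n (windowMap d ((n + 1) * 3 ^ k) x)) = y' then 1 else 0)
    (b₀ p : X d) :
    Tendsto (fun k : ℕ => ∑ y' : Site d (3 ^ k), (Matrix.of fun y y' : Site d (3 ^ k) =>
        (((n : ℝ) + 1) ^ d)⁻¹ * ∑ z : Fin d → Fin (n + 1), ψ k y' (siteOf d ((n + 1) * 3 ^ k) (chart n (windowMap d (3 ^ k) y) z)))⁻¹
        y' (siteOf d (3 ^ k) b₀) * ψ k y' (siteOf d ((n + 1) * 3 ^ k) p)) atTop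
      (𝓝 (∑' b' : X d, M b' b₀ * Ψ b' p)) := by
  classical
  have hm0 : 0 < min 2 a - lam := by linarith
  obtain ⟨C₀, hC₀, H152⟩ := supNorm_bound_road (d := d) hd a ha hlam hLam
  obtain ⟨c₁, δ₁, hc₁, hδ₁, H135⟩ := nextScale_hessian_local (d := d) a ha hm0 hLam
  -- abbreviations: the torus inverse kernels and the window-supported `ℤ^d` terms
  obtain ⟨Tinv, hTinv⟩ : ∃ Tinv : (k : ℕ) → Site d (3 ^ k) → Site d (3 ^ k) → ℝ, ∀ k y y', Tinv k y y' =
      (Matrix.of fun y y' : Site d (3 ^ k) => (((n : ℝ) + 1) ^ d)⁻¹ * ∑ z : Fin d → Fin (n + 1),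
        ψ k y' (siteOf d ((n + 1) * 3 ^ k) (chart n (windowMap d (3 ^ k) y) z)))⁻¹ y y' := ⟨_, fun _ _ _ => rfl⟩
  obtain ⟨F, hF⟩ : ∃ F : ℕ → X d → ℝ, ∀ k b', F k b' =
      if windowMap d (3 ^ k) (siteOf d (3 ^ k) b') = b' then
        Tinv k (siteOf d (3 ^ k) b') (siteOf d (3 ^ k) b₀) * ψ k (siteOf d (3 ^ k) b') (siteOf d ((n + 1) * 3 ^ k) p) else 0 :=
    ⟨_, fun _ _ => rfl⟩
  -- uniform bounds: `|ψ^k| ≤ C₀`, `|T_k⁻¹(y′,y₀)| ≤ c₁e^{−δ₁ρ_k(y′,y₀)}`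
  have hψB : ∀ k y' x, |ψ k y' x| ≤ C₀ * 1 := fun k y' x =>
    H152 n (3 ^ k) (fun x => V (windowMap d ((n + 1) * 3 ^ k) x)) (fun x => hV _) (fun x => hV' _) 1 (ψ k y')
      (fun x => if siteOf d (3 ^ k) (blk n (windowMap d ((n + 1) * 3 ^ k) x)) = y' then (1 : ℝ) else 0)
      (fun x => by split_ifs <;> simp) (hψ k y') x
  have hTB : ∀ k (y y' : Site d (3 ^ k)), |Tinv k y y'| ≤ c₁ * exp (-(δ₁ * ∑ i, (((y i - y' i).valMinAbs.natAbs : ℕ) : ℝ))) :=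
    fun k y y' => by
      rw [hTinv]
      exact H135 n (3 ^ k) (fun x => V (windowMap d ((n + 1) * 3 ^ k) x)) (fun x => hV _) (fun x => hV' _) (ψ k) (hψ k) y y'
  -- the torus sum IS the `ℤ^d` series of `F k`
  have hsum : ∀ k : ℕ, ∑ y' : Site d (3 ^ k), Tinv k y' (siteOf d (3 ^ k) b₀) * ψ k y' (siteOf d ((n + 1) * 3 ^ k) p)
      = ∑' b' : X d, F k b' := by
    intro k
    set W : Finset (X d) := (Finset.univ : Finset (Site d (3 ^ k))).image (windowMap d (3 ^ k)) with hW
    have hWrep : ∀ b' ∈ W, windowMap d (3 ^ k) (siteOf d (3 ^ k) b') = b' := fun b' hb' => by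
      obtain ⟨y, -, hy⟩ := Finset.mem_image.1 hb'; rw [← hy, siteOf_windowMap]
    have hF0 : ∀ b', b' ∉ W → F k b' = 0 := fun b' hb' => by
      rw [hF, if_neg]
      intro h
      exact hb' (Finset.mem_image.2 ⟨siteOf d (3 ^ k) b', Finset.mem_univ _, h⟩)
    rw [tsum_eq_sum (s := W) (fun b' hb' => hF0 b' hb'), ← sum_window_reading (3 ^ k) W hWrep (F k) hF0]
    refine Finset.sum_congr rfl fun y' _ => ?_
    rw [hF, if_pos (by rw [siteOf_windowMap]), siteOf_windowMap]
  -- termwise convergence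
  have hlim : ∀ b' : X d, Tendsto (fun k => F k b') atTop (𝓝 (M b' b₀ * Ψ b' p)) := by
    intro b'
    -- the inverse kernel ((199))
    have h1 : Tendsto (fun k => Tinv k (siteOf d (3 ^ k) b') (siteOf d (3 ^ k) b₀)) atTop (𝓝 (M b' b₀)) := by
      have h := torus_nextScale_inverse_tendsto hd a ha hlam hLam n V hV hV' Ψ BΨ hΨB hΨ M hM ψ hψ b' b₀
      refine h.congr fun k => ?_
      rw [hTinv]
    -- the block column ((184), as in (186)): beyond the window radius of `b′`, `ψ^k_{σb′}` is the torus solution of the window reading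
    set f : X d → ℝ := fun q => if blk n q = b' then 1 else 0 with hf
    have hfM : ∀ q, |f q| ≤ 1 := fun q => by simp only [hf]; split_ifs <;> simp
    choose w hw using fun k : ℕ => action_surjective n a (3 ^ k) ha.le hm0 (fun x => V (windowMap d ((n + 1) * 3 ^ k) x))
      (fun x => hV _) (fun x => f (windowMap d ((n + 1) * 3 ^ k) x))
    have hwlim := bounded_solution_is_tower_limit hd a ha hlam hLam n V hV hV' f hfM (Ψ b') (hΨB b') (hΨ b') w hw p
    set k₁ : ℕ := 2 * ∑ i, (b' i).natAbs + 2 with hk₁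
    have hcol : ∀ k, k₁ ≤ k → ψ k (siteOf d (3 ^ k) b') = w k := by
      intro k hk
      refine action_injective n a (3 ^ k) ha.le hm0 (fun x => V (windowMap d ((n + 1) * 3 ^ k) x)) (fun x => hV _) _ _ fun x => ?_
      rw [hψ k (siteOf d (3 ^ k) b') x, hw k x]
      simp only [hf, blockSource_window_reading n k b' (by rw [hk₁] at hk; exact hk) x]
    have h2 : Tendsto (fun k => ψ k (siteOf d (3 ^ k) b') (siteOf d ((n + 1) * 3 ^ k) p)) atTop (𝓝 (Ψ b' p)) := by
      refine hwlim.congr' (Filter.eventually_atTop.2 ⟨k₁, fun k hk => ?_⟩)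
      beta_reduce; rw [hcol k hk]
    -- the window indicator is eventually `1`
    have hwin : ∀ k, k₁ ≤ k → windowMap d (3 ^ k) (siteOf d (3 ^ k) b') = b' := fun k hk =>
      windowMap_siteOf d (3 ^ k) fun i => by
        have h := inWindow_of_le 0 k b' (by rw [hk₁] at hk; omega) i
        simpa using h
    refine (h1.mul h2).congr' (Filter.eventually_atTop.2 ⟨k₁, fun k hk => ?_⟩)
    beta_reduce; rw [hF, if_pos (hwin k hk)]
  -- summable domination, uniform in `k`
  have hdom : ∀ k b', ‖F k b'‖ ≤ c₁ * exp (δ₁ * ∑ i, (((b₀ i).natAbs : ℕ) : ℝ)) * (C₀ * 1)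
      * exp (-(δ₁ * ∑ i, ((((0 : X d) i - b' i).natAbs : ℕ) : ℝ))) := by
    intro k b'
    rw [Real.norm_eq_abs, hF]
    split_ifs with hwin
    · rw [abs_mul]
      have e1 := hTB k (siteOf d (3 ^ k) b') (siteOf d (3 ^ k) b₀)
      have e2 := hψB k (siteOf d (3 ^ k) b') (siteOf d ((n + 1) * 3 ^ k) p)
      -- `ρ_k(σb′, σb₀) ≥ |b′|₁ − |b₀|₁` on the window
      have htri := (isPseudoDist_torus (d := d) (3 ^ k)).triangle (siteOf d (3 ^ k) b') (siteOf d (3 ^ k) b₀) 0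
      have hN0 : ∀ y : Site d (3 ^ k), ∑ i, (((y i - (0 : Site d (3 ^ k)) i).valMinAbs.natAbs : ℕ) : ℝ)
          = ∑ i, ((((y i).valMinAbs).natAbs : ℕ) : ℝ) := fun y => Finset.sum_congr rfl fun i _ => by simp
      rw [hN0, hN0, torusNorm_eq_l1 k (siteOf d (3 ^ k) b'), hwin] at htri
      have e3 := torusNorm_le_l1 (d := d) (3 ^ k) b₀
      have hb'0 : ∑ i, ((((0 : X d) i - b' i).natAbs : ℕ) : ℝ) = ∑ i, (((b' i).natAbs : ℕ) : ℝ) :=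
        Finset.sum_congr rfl fun i _ => by simp
      rw [hb'0]
      have e4 : c₁ * exp (-(δ₁ * ∑ i, ((((siteOf d (3 ^ k) b') i - (siteOf d (3 ^ k) b₀) i).valMinAbs.natAbs : ℕ) : ℝ)))
          ≤ c₁ * exp (δ₁ * ∑ i, (((b₀ i).natAbs : ℕ) : ℝ)) * exp (-(δ₁ * ∑ i, (((b' i).natAbs : ℕ) : ℝ))) := by
        rw [mul_assoc, ← exp_add]
        exact mul_le_mul_of_nonneg_left (exp_le_exp.2 (by nlinarith)) hc₁.le
      calc |Tinv k (siteOf d (3 ^ k) b') (siteOf d (3 ^ k) b₀)| * |ψ k (siteOf d (3 ^ k) b') (siteOf d ((n + 1) * 3 ^ k) p)|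
          ≤ (c₁ * exp (δ₁ * ∑ i, (((b₀ i).natAbs : ℕ) : ℝ)) * exp (-(δ₁ * ∑ i, (((b' i).natAbs : ℕ) : ℝ)))) * (C₀ * 1) :=
            mul_le_mul (e1.trans e4) e2 (abs_nonneg _) (by positivity)
        _ = _ := by ring
    · rw [abs_zero]; positivity
  have hbsum : Summable fun b' : X d => c₁ * exp (δ₁ * ∑ i, (((b₀ i).natAbs : ℕ) : ℝ)) * (C₀ * 1)
      * exp (-(δ₁ * ∑ i, ((((0 : X d) i - b' i).natAbs : ℕ) : ℝ))) := (summable_exp_l1 hδ₁ 0).mul_left _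
  have hT := tendsto_tsum_of_dominated_convergence hbsum hlim (Eventually.of_forall hdom)
  refine hT.congr fun k => ?_
  rw [← hsum k]
  exact Finset.sum_congr rfl fun y' _ => by rw [hTinv]

/-! ## §2. Toy -/

/-- Toy (`d = 2`): the summable domination profile around the origin of `ℤ²`. -/
example : Summable fun b' : X 2 => exp (-(1 * ∑ i, ((((0 : X 2) i - b' i).natAbs : ℕ) : ℝ))) := summable_exp_l1 (d := 2) one_pos 0

end Summit.QuantumFields.BalabanUV.T4Continuum.NE7b.SupZdResponseTorusLimit
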